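import Summits.NavierStokesRegularity.NavierStokesRegularity.Theorems.SoloRefuteKyritsis2022
import HarnessLib

/-!
# NS-claims map, C03 (Kyritsis 2022), part 2/3: the `ℤ³`-periodic Euler shear flow

Second of the three files into which ns-claims-refuter-1's kernel checks of the typed skeleton
`Literature.Claims.NS.Kyritsis2022` are split (gate lint: Theorems files with proofs ≤ 400 lines;
filed for the author by ns-claims-salvage-p4, content unchanged). Part 1
(`SoloRefuteKyritsis2022.lean`): toolkit, static countermodel, `not_Step_6` and the full description
of all countermodels; this part: the dynamic countermodel `u(t,x) = (sin 2πx₁, 0, sin 2π(x₀ − t sin 2πx₁))`,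
`p = 0` — a global smooth `ℤ³`-periodic classical Euler solution, its vorticity and stretching at the
stagnation point `0`; part 3 (`SoloRefuteKyritsis2022Flow.lean`): trajectory maps and
`not_Theorem44Infinite`, `not_Step_11`, `not_Step_10`. Print locators: K. E. Kyritsis, J. Appl.
Math. Phys. 10 (2022) 2538–2560, Thm 4.4 pp. 2553–2555. Axioms: `propext`, `Classical.choice`,
`Quot.sound` only.
WHAT THIS IS NOT: not a claim about NS regularity or blow-up; not a claim about any author beyond
the typed locator.
-/


noncomputable section

open Real Set Function MeasureTheory InnerProductSpace
open Literature.Analysis.FluidPDE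
open scoped ContDiff RealInnerProductSpace

-- The summit's canonical theorem namespace repeats the summit name (single-conjunct summit).
set_option linter.dupNamespace false

namespace Summit.NavierStokesRegularity.NavierStokesRegularity.Theorems.Kyritsis2022

/-! ## The dynamic countermodel: the `ℤ³`-periodic Euler shear flow with its explicit flow map

`u(t,x) = (sin 2πx₁, 0, sin 2π(x₀ − t sin 2πx₁))`, `p = 0`: a global smooth `ℤ³`-periodic
solution of the Euler equations (`ν = 0`, no force) on `ℝ³ × ℝ`, with particle-trajectory map
`X(t,a) = (a₀ + t sin 2πa₁, a₁, a₂ + t sin 2πa₀)` (explicit smooth inverse, Jacobian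
determinant `1`), bounded initial vorticity `|ω(0,·)| ≤ 4π`, and `ω(t,0) = (−4π²t, −2π, −2π)`
at the stagnation point `0`: vortex stretching, linear in `t`. -/

/-- The shear flow `u(t,x) = (sin 2πx₁, 0, sin 2π(x₀ − t sin 2πx₁))`. -/
def shear (t : ℝ) (x : EuclideanSpace ℝ (Fin 3)) : EuclideanSpace ℝ (Fin 3) :=
  !₂[sin (2 * π * x 1), 0, sin (2 * π * (x 0 - t * sin (2 * π * x 1)))]

/-- Component `0` of the shear flow. -/
@[simp] theorem shear_apply_zero (t : ℝ) (x : EuclideanSpace ℝ (Fin 3)) :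
    shear t x 0 = sin (2 * π * x 1) := by
  simp [shear]

/-- Component `1` of the shear flow. -/
@[simp] theorem shear_apply_one (t : ℝ) (x : EuclideanSpace ℝ (Fin 3)) : shear t x 1 = 0 := by
  simp [shear]

/-- Component `2` of the shear flow. -/
@[simp] theorem shear_apply_two (t : ℝ) (x : EuclideanSpace ℝ (Fin 3)) :
    shear t x 2 = sin (2 * π * (x 0 - t * sin (2 * π * x 1))) := by
  simp [shear]

/-- The shear flow in the standard basis. -/
theorem shear_eq (t : ℝ) (x : EuclideanSpace ℝ (Fin 3)) :
    shear t x =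
      sin (2 * π * x 1) • bv 0 + sin (2 * π * (x 0 - t * sin (2 * π * x 1))) • bv 2 := by
  ext i
  fin_cases i <;> simp

/-- Coordinate projections are their own derivative. [folklore] -/
private theorem hasFDerivAt_coord (j : Fin 3) (x : EuclideanSpace ℝ (Fin 3)) :
    HasFDerivAt (fun y : EuclideanSpace ℝ (Fin 3) => y j) (pr j) x :=
  (pr j).hasFDerivAt

/-- The space derivative of the shear flow at time `t`. -/
private theorem hasFDerivAt_shear (t : ℝ) (x : EuclideanSpace ℝ (Fin 3)) :
    HasFDerivAt (shear t)
      ((cos (2 * π * x 1) • ((2 * π) • pr 1)).smulRight (bv 0) +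
        (cos (2 * π * (x 0 - t * sin (2 * π * x 1))) •
          ((2 * π) • (pr 0 - t • (cos (2 * π * x 1) • ((2 * π) • pr 1))))).smulRight
          (bv 2)) x := by
  have e : shear t = fun y : EuclideanSpace ℝ (Fin 3) =>
      sin (2 * π * y 1) • bv 0 + sin (2 * π * (y 0 - t * sin (2 * π * y 1))) • bv 2 :=
    funext (shear_eq t)
  rw [e]
  have h0 := ((hasFDerivAt_coord 1 x).const_mul (2 * π)).sin.smul_const (bv 0)
  have h2 := (((hasFDerivAt_coord 0 x).sub
    (((hasFDerivAt_coord 1 x).const_mul (2 * π)).sin.const_mul t)).const_mul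
      (2 * π)).sin.smul_const (bv 2)
  exact h0.add h2

/-- Jacobian table of the shear flow: row `j` = `∂/∂xⱼ`, column `i` = component. -/
def jac (t : ℝ) (x : EuclideanSpace ℝ (Fin 3)) : Fin 3 → Fin 3 → ℝ :=
  ![![0, 0, 2 * π * cos (2 * π * (x 0 - t * sin (2 * π * x 1)))],
    ![2 * π * cos (2 * π * x 1), 0,
      -(4 * π ^ 2 * t * cos (2 * π * x 1) * cos (2 * π * (x 0 - t * sin (2 * π * x 1))))],
    ![0, 0, 0]]

/-- Entries of the space derivative of the shear flow. -/
theorem fderiv_shear_single (t : ℝ) (x : EuclideanSpace ℝ (Fin 3)) (j i : Fin 3) :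
    fderiv ℝ (shear t) x (bv j) i = jac t x j i := by
  rw [(hasFDerivAt_shear t x).fderiv]
  fin_cases j <;> fin_cases i <;> simp [jac] <;> ring

/-- The shear flow is divergence free. -/
theorem isDivFree_shear (t : ℝ) : VectorCalculus.IsDivFree (shear t) := fun x => by
  rw [VectorCalculus.divergence, trace_eq_sum_coord, Fin.sum_univ_three]
  have h : ∀ j i : Fin 3, fderiv ℝ (shear t) x (EuclideanSpace.single j 1) i = jac t x j i :=
    fderiv_shear_single t x
  rw [h, h, h]
  simp [jac]

/-- The vorticity of the shear flow. -/
theorem curl_shear (t : ℝ) (x : EuclideanSpace ℝ (Fin 3)) :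
    curl (shear t) x =
      !₂[-(4 * π ^ 2 * t * cos (2 * π * x 1) * cos (2 * π * (x 0 - t * sin (2 * π * x 1)))),
        -(2 * π * cos (2 * π * (x 0 - t * sin (2 * π * x 1)))),
        -(2 * π * cos (2 * π * x 1))] := by
  rw [curl_eq_curlCLM, curlCLM_apply]
  have h : ∀ j i : Fin 3, fderiv ℝ (shear t) x (EuclideanSpace.single j 1) i = jac t x j i :=
    fderiv_shear_single t x
  simp only [h]
  ext i
  fin_cases i <;> simp [jac]

/-- At the origin the vorticity is `(−4π²t, −2π, −2π)`. -/
theorem curl_shear_origin (t : ℝ) :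
    curl (shear t) 0 = !₂[-(4 * π ^ 2 * t), -(2 * π), -(2 * π)] := by
  rw [curl_shear]
  simp

/-- Linear growth of the vorticity at the stagnation point: `4π² t ≤ |ω(t,0)|`. -/
theorem le_norm_curl_shear_origin {t : ℝ} (ht : 0 ≤ t) :
    4 * π ^ 2 * t ≤ ‖curl (shear t) 0‖ := by
  rw [curl_shear_origin]
  have h := PiLp.norm_apply_le
    (!₂[-(4 * π ^ 2 * t), -(2 * π), -(2 * π)] : EuclideanSpace ℝ (Fin 3)) 0
  have h4 : ‖(!₂[-(4 * π ^ 2 * t), -(2 * π), -(2 * π)] : EuclideanSpace ℝ (Fin 3)) 0‖ =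
      4 * π ^ 2 * t := by
    simp [abs_of_nonneg ht]
  rwa [h4] at h

/-- The initial vorticity is bounded: `|ω(0,x)| ≤ 4π`. -/
theorem norm_curl_shear_zero_le (x : EuclideanSpace ℝ (Fin 3)) :
    ‖curl (shear 0) x‖ ≤ 4 * π := by
  rw [curl_shear, EuclideanSpace.norm_eq]
  simp only [Fin.sum_univ_three]
  simp only [Matrix.cons_val_zero, Matrix.cons_val_one, Matrix.cons_val, zero_mul, mul_zero,
    sub_zero, neg_zero]
  have hc0 : (cos (2 * π * x 0)) ^ 2 ≤ 1 := by
    rw [sq_le_one_iff_abs_le_one]; exact abs_cos_le_one _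
  have hc1 : (cos (2 * π * x 1)) ^ 2 ≤ 1 := by
    rw [sq_le_one_iff_abs_le_one]; exact abs_cos_le_one _
  calc Real.sqrt (‖(0:ℝ)‖ ^ 2 + ‖-(2 * π * cos (2 * π * x 0))‖ ^ 2
        + ‖-(2 * π * cos (2 * π * x 1))‖ ^ 2)
      ≤ Real.sqrt ((4 * π) ^ 2) := by
        apply Real.sqrt_le_sqrt
        simp only [norm_zero, norm_neg, Real.norm_eq_abs, sq_abs]
        nlinarith [Real.pi_pos, mul_nonneg (sq_nonneg π) (sub_nonneg.2 hc0),
          mul_nonneg (sq_nonneg π) (sub_nonneg.2 hc1)]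
    _ = 4 * π := Real.sqrt_sq (by positivity)

/-- The typed hypothesis `F_ω < ∞` at time `0`. -/
theorem bddAbove_norm_curl_shear_zero : BddAbove (Set.range fun y => ‖curl (shear 0) y‖) :=
  ⟨4 * π, by rintro _ ⟨y, rfl⟩; exact norm_curl_shear_zero_le y⟩

/-- The time derivative of the shear flow at a fixed point. -/
private theorem hasDerivAt_shear_time (t : ℝ) (x : EuclideanSpace ℝ (Fin 3)) :
    HasDerivAt (fun s => shear s x)
      ((-(2 * π * sin (2 * π * x 1) * cos (2 * π * (x 0 - t * sin (2 * π * x 1))))) • bv 2)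
      t := by
  have e : (fun s => shear s x) = fun s =>
      sin (2 * π * x 1) • bv 0 + sin (2 * π * (x 0 - s * sin (2 * π * x 1))) • bv 2 :=
    funext fun s => shear_eq s x
  rw [e]
  have h := ((((hasDerivAt_id' t).mul_const (sin (2 * π * x 1))).const_sub (x 0)).const_mul
    (2 * π)).sin.smul_const (bv 2)
  exact ((hasDerivAt_const t (sin (2 * π * x 1) • bv 0)).add h).congr_deriv (by
    rw [zero_add]
    congr 1
    ring)

/-- `∂ₜ u` of the shear flow (two-sided, time set `univ`). -/
theorem timeDerivWithin_shear (t : ℝ) (x : EuclideanSpace ℝ (Fin 3)) :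
    timeDerivWithin univ shear t x =
      (-(2 * π * sin (2 * π * x 1) * cos (2 * π * (x 0 - t * sin (2 * π * x 1))))) •
        bv 2 := by
  rw [timeDerivWithin_apply, derivWithin_univ]
  exact (hasDerivAt_shear_time t x).deriv

/-- `(u·∇)u` of the shear flow. -/
theorem convect_shear (t : ℝ) (x : EuclideanSpace ℝ (Fin 3)) :
    convect (shear t) (shear t) x =
      (2 * π * sin (2 * π * x 1) * cos (2 * π * (x 0 - t * sin (2 * π * x 1)))) • bv 2 := by
  ext i
  have h : ∀ j i : Fin 3, fderiv ℝ (shear t) x (EuclideanSpace.single j 1) i = jac t x j i :=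
    fderiv_shear_single t x
  rw [convect, clm_apply_coord, Fin.sum_univ_three, h, h, h]
  fin_cases i <;> simp [jac, mul_comm, mul_left_comm, mul_assoc]

/-- `∂ₜu + (u·∇)u = 0` for the shear flow. -/
theorem transport_shear (t : ℝ) (x : EuclideanSpace ℝ (Fin 3)) :
    timeDerivWithin univ shear t x + convect (shear t) (shear t) x = 0 := by
  rw [timeDerivWithin_shear, convect_shear, neg_smul, neg_add_cancel]

/-- Joint smoothness of the shear flow in `(t, x)`. -/
theorem contDiff_uncurry_shear : ContDiff ℝ ∞ (uncurry shear) := by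
  have hc : ∀ j : Fin 3, ContDiff ℝ ∞ (fun q : ℝ × EuclideanSpace ℝ (Fin 3) => q.2 j) :=
    fun j => (pr j).contDiff.comp contDiff_snd
  have e : uncurry shear = fun q : ℝ × EuclideanSpace ℝ (Fin 3) =>
      sin (2 * π * q.2 1) • bv 0
        + sin (2 * π * (q.2 0 - q.1 * sin (2 * π * q.2 1))) • bv 2 := by
    funext q
    exact shear_eq q.1 q.2
  rw [e]
  exact ((contDiff_const.mul (hc 1)).sin.smul contDiff_const).add
    ((contDiff_const.mul ((hc 0).sub (contDiff_fst.mul (contDiff_const.mul (hc 1)).sin))).sin.smul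
      contDiff_const)

/-- **The shear flow is a global classical Euler solution** on `ℝ³ × ℝ`, no force, zero
pressure. -/
theorem isClassicalEulerSolutionOn_shear :
    IsClassicalEulerSolutionOn univ 0 shear (fun _ _ => 0) where
  smooth_velocity := contDiff_uncurry_shear.contDiffOn
  smooth_pressure := contDiffOn_const
  momentum t _ x := by
    rw [transport_shear]
    simp [gradient_fun_const]
  divFree t _ := isDivFree_shear t

/-- The shear flow solves the Euler system on every time set with unique derivatives. -/
theorem isClassicalNSSolutionOn_shear {S : Set ℝ} (hS : UniqueDiffOn ℝ S) :
    IsClassicalNSSolutionOn S 0 0 shear (fun _ _ => 0) :=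
  isClassicalEulerSolutionOn_shear.mono (subset_univ S) hS

/-- `ℤ³`-periodicity of the shear flow at every time (the printed periodic setting). -/
theorem isLatticePeriodic_shear (t : ℝ) : IsLatticePeriodic (shear t) := by
  intro j x
  have hsin : ∀ a : ℝ, sin (2 * π * (a + 1)) = sin (2 * π * a) := fun a => by
    rw [mul_add, mul_one, sin_add_two_pi]
  have hsin' : ∀ a b : ℝ, sin (2 * π * (a + 1 - b)) = sin (2 * π * (a - b)) := fun a b => by
    rw [show a + 1 - b = (a - b) + 1 by ring, hsin]
  ext i
  fin_cases i <;> fin_cases j <;> simp [shear, hsin, hsin']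


end Summit.NavierStokesRegularity.NavierStokesRegularity.Theorems.Kyritsis2022

end
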